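import Summits.Ventures.LatticeQCDFlow.Scaling.IdealStarStaleCollector

/-!
HONEST FRAMING: exact (Metropolis-corrected) sampling algorithms for lattice gauge theory; figures
of merit are autocorrelation/cost numbers at stated couplings and volumes; no continuum-physics
claim.

# IdealStarStaleSteps — ONE STEP OF CHAPTER L's STALE-SET CHAIN ON THE STALE POTENTIAL `Φ(D) = |D∖{0}| + t·𝟙{0 ∈ D}`: `E[𝟙{0∈D'}|D] = (t/K)|D∖{0}|`, `E[Φ(D')|D] = Φ(D) − λ|D∖{0}|`,
# `E[Φ(D')²|D] ≤ (1−2λ)Φ(D)² + λ(1−t)|D∖{0}| + (3t(1−t) + 2λt²)𝟙{0∈D}`, `λ = t(1−t)/K` AT UNIFORM LISTING — A STALE COLD LEVEL IS LOST ONLY BY CAPTURE THEN REFRESH (lean-2 GEN-45, ours)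

Venture-side (OURS).  Cell `lqcd-flow` (pub-lqcd), unit `pub-lqcd-lean-2-g45`, 2026-08-31.  Chapter AE, file 10 — the one-step identities behind file 11's two-moment bound in the ceiling's
unit `K/(t(1−t))`.  Objects: the stale-set chain `Q` of `Scaling/DirtySetDecay` (hypothesis-equation `hQ`; hub list `(0, κ_r+1)` with `c` entries per cold level, `m = cK`).  The
potential counts a stale cold level `1` and a stale hub `t` (its probability of escaping the next refresh) — GEN-27's unit-survival potential, here on the stale set, where nothing
can be re-planted (no leakage terms).

* `stale_sum_fun` (`Σ_{D'}Q(D,D')f(D') = Σ_r (t/m)f((0 κ_r+1)(D)) + (1−t)f(D∖{0})`), `zero_mem_image_swap_iff`, `sum_indicator_succ_mem` (`Σ_r 𝟙{κ_r+1 ∈ D} = c|D∖{0}|`),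
  `stale_sum_affine` (`Σ_r (t/m)(X + Y𝟙{κ_r+1∈D}) = tX + (tc/m)Y|D∖{0}|`), **`stale_hub_step`**, **`stale_potential_step`**, **`stale_potential_sq_step`**.

Reading (no numerics implied): the drift `−λ|D∖{0}|` with `λ = t(1−t)/K` is the product (capture rate `t/K` per stale cold level) × (refresh-before-escape probability `1−t`):
the unit `K/(t(1−t))` of GEN-27's two-sided law.  Literature grade (cell rule): OWN, elementary; nothing cited as a fact; no new bib keys.
-/

noncomputable section

open Finset Function
open Literature.Probability.MarkovChains

namespace Summit.Ventures.LatticeQCDFlow.Scaling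

section StaleSteps
variable {K m : ℕ} (κ : Fin m → Fin K) {t : ℝ} {Q : Finset (Fin (K + 1)) → Finset (Fin (K + 1)) → ℝ}

/-! ## §1 One step of `Q` on the stale potential -/
/-- `Σ_{D'} Q(D,D')·f(D') = Σ_r (t/m)·f((0 κ_r+1)(D)) + (1−t)·f(D∖{0})`. [ours] -/
theorem stale_sum_fun
    (hQ : ∀ D D', Q D D' = ∑ r : Fin m, t / m * (if D' = D.image (Equiv.swap (0 : Fin (K + 1)) (κ r).succ) then (1 : ℝ)
      else 0) + (1 - t) * (if D' = D.erase 0 then (1 : ℝ) else 0)) (D : Finset (Fin (K + 1))) (f : Finset (Fin (K + 1)) → ℝ) :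
    ∑ D', Q D D' * f D' = ∑ r : Fin m, t / m * f (D.image (Equiv.swap (0 : Fin (K + 1)) (κ r).succ)) + (1 - t) * f (D.erase 0) := by
  classical
  have hpt : ∀ (D' X : Finset (Fin (K + 1))), (if D' = X then (1 : ℝ) else 0) * f D' = (if D' = X then f X else 0) := by
    intro D' X; by_cases h : D' = X
    · rw [if_pos h, if_pos h, h, one_mul]
    · rw [if_neg h, if_neg h, zero_mul]
  simp_rw [hQ, add_mul, sum_mul, sum_add_distrib]
  congr 1
  · rw [sum_comm]
    refine sum_congr rfl fun r _ => ?_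
    simp_rw [mul_assoc, ← mul_sum, hpt, Finset.sum_ite_eq' univ, if_pos (mem_univ _)]
  · simp_rw [mul_assoc, ← mul_sum, hpt, Finset.sum_ite_eq' univ, if_pos (mem_univ _)]

omit κ in
/-- `0 ∈ (0 l)(D) ↔ l ∈ D`. [ours] -/
theorem zero_mem_image_swap_iff (D : Finset (Fin (K + 1))) (l : Fin (K + 1)) : (0 : Fin (K + 1)) ∈ D.image (Equiv.swap (0 : Fin (K + 1)) l) ↔ l ∈ D := by
  constructor
  · intro h
    obtain ⟨k, hk, hk0⟩ := mem_image.mp h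
    have : k = l := by
      have := congrArg (Equiv.swap (0 : Fin (K + 1)) l).symm hk0
      rw [Equiv.symm_apply_apply] at this
      rw [this, Equiv.symm_swap, Equiv.swap_apply_left]
    rw [← this]; exact hk
  · intro h; exact mem_image.mpr ⟨l, h, by rw [Equiv.swap_apply_right]⟩

/-- At uniform listing, `Σ_r 𝟙{κ_r+1 ∈ D} = c·|D∖{0}|`. [ours] -/
theorem sum_indicator_succ_mem {c : ℕ} (hunif : ∀ i : Fin K, (univ.filter fun r : Fin m => κ r = i).card = c) (D : Finset (Fin (K + 1))) :
    ∑ r : Fin m, (if (κ r).succ ∈ D then (1 : ℝ) else 0) = c * ((D.erase 0).card : ℝ) := by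
  classical
  have e2 : ∀ r : Fin m, (if (κ r).succ ∈ D then (1 : ℝ) else 0) = ∑ l ∈ D.erase 0, (if (κ r).succ = l then (1 : ℝ) else 0) := by
    intro r
    rw [Finset.sum_ite_eq]
    by_cases h : (κ r).succ ∈ D
    · rw [if_pos h, if_pos (Finset.mem_erase.mpr ⟨Fin.succ_ne_zero _, h⟩)]
    · rw [if_neg h, if_neg (fun h' => h (Finset.mem_erase.mp h').2)]
  simp_rw [e2]
  rw [sum_comm]
  have e3 : ∀ l ∈ D.erase 0, ∑ r : Fin m, (if (κ r).succ = l then (1 : ℝ) else 0) = c := by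
    intro l hl
    obtain ⟨hl0, -⟩ := Finset.mem_erase.mp hl
    obtain ⟨p, rfl⟩ := Fin.exists_succ_eq.mpr hl0
    rw [show (∑ r : Fin m, (if (κ r).succ = p.succ then (1 : ℝ) else 0)) = ∑ r : Fin m, (if κ r = p then (1 : ℝ) else 0) from
      sum_congr rfl fun r _ => by simp only [Fin.succ_inj]]
    rw [← Finset.sum_filter, sum_const, nsmul_eq_mul, mul_one, hunif p]
  rw [sum_congr rfl e3, sum_const, nsmul_eq_mul, mul_comm]

/-- `Σ_r (t/m)·(X + Y·𝟙{κ_r+1 ∈ D}) = t·X + (tc/m)·Y·|D∖{0}|` at uniform listing (`m ≥ 1`). [ours] -/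
theorem stale_sum_affine (hm : 1 ≤ m) {c : ℕ} (hunif : ∀ i : Fin K, (univ.filter fun r : Fin m => κ r = i).card = c) (D : Finset (Fin (K + 1))) (X Y : ℝ) :
    ∑ r : Fin m, t / m * (X + Y * (if (κ r).succ ∈ D then (1 : ℝ) else 0)) = t * X + t * c / m * Y * ((D.erase 0).card : ℝ) := by
  classical
  have hmpos : (0 : ℝ) < m := Nat.cast_pos.mpr (by omega)
  have e : ∀ r : Fin m, t / m * (X + Y * (if (κ r).succ ∈ D then (1 : ℝ) else 0)) = t / m * X + (t / m * Y) * (if (κ r).succ ∈ D then (1 : ℝ) else 0) := fun r => by ring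
  rw [sum_congr rfl fun r _ => e r, sum_add_distrib, sum_const, card_univ, Fintype.card_fin, nsmul_eq_mul, ← mul_sum, sum_indicator_succ_mem κ hunif D]
  field_simp

/-- **THE HUB INDICATOR:** `Σ_{D'} Q(D,D')·𝟙{0 ∈ D'} = (tc/m)·|D∖{0}|` — the hub is stale after a step exactly when a stale cold level was swapped in. [ours] -/
theorem stale_hub_step
    (hQ : ∀ D D', Q D D' = ∑ r : Fin m, t / m * (if D' = D.image (Equiv.swap (0 : Fin (K + 1)) (κ r).succ) then (1 : ℝ)
      else 0) + (1 - t) * (if D' = D.erase 0 then (1 : ℝ) else 0))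
    {c : ℕ} (hunif : ∀ i : Fin K, (univ.filter fun r : Fin m => κ r = i).card = c) (D : Finset (Fin (K + 1))) :
    ∑ D', Q D D' * (if (0 : Fin (K + 1)) ∈ D' then (1 : ℝ) else 0) = t * c / m * ((D.erase 0).card : ℝ) := by
  classical
  rw [stale_sum_fun κ hQ D]
  have e1 : ∀ r : Fin m, (if (0 : Fin (K + 1)) ∈ D.image (Equiv.swap (0 : Fin (K + 1)) (κ r).succ) then (1 : ℝ) else 0) = (if (κ r).succ ∈ D then (1 : ℝ) else 0) := by
    intro r; simp only [zero_mem_image_swap_iff]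
  simp_rw [e1]
  rw [if_neg (Finset.notMem_erase 0 D), mul_zero, add_zero, ← mul_sum, sum_indicator_succ_mem κ hunif D]
  ring

/-- **THE POTENTIAL'S DRIFT:** `Σ_{D'} Q(D,D')·Φ(D') = Φ(D) − (t(1−t)c/m)·|D∖{0}|`, `Φ(D) = |D∖{0}| + t·𝟙{0∈D}` — a swap `(0 l)` with `l` stale exchanges a unit worth `1` for one worth `t`.
[ours] -/
theorem stale_potential_step (hm : 1 ≤ m)
    (hQ : ∀ D D', Q D D' = ∑ r : Fin m, t / m * (if D' = D.image (Equiv.swap (0 : Fin (K + 1)) (κ r).succ) then (1 : ℝ)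
      else 0) + (1 - t) * (if D' = D.erase 0 then (1 : ℝ) else 0))
    {c : ℕ} (hunif : ∀ i : Fin K, (univ.filter fun r : Fin m => κ r = i).card = c) (D : Finset (Fin (K + 1))) :
    ∑ D', Q D D' * (((D'.erase 0).card : ℝ) + t * (if (0 : Fin (K + 1)) ∈ D' then (1 : ℝ) else 0))
      = (((D.erase 0).card : ℝ) + t * (if (0 : Fin (K + 1)) ∈ D then (1 : ℝ) else 0)) - t * (1 - t) * c / m * ((D.erase 0).card : ℝ) := by
  classical
  have hmpos : (0 : ℝ) < m := Nat.cast_pos.mpr (by omega)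
  rw [stale_sum_fun κ hQ D]
  -- after a swap `(0 l)`: `|D'∖0| = |D∖0| + 𝟙{0∈D} − 𝟙{l∈D}`, `𝟙{0∈D'} = 𝟙{l∈D}`
  have e1 : ∀ r : Fin m, (((D.image (Equiv.swap (0 : Fin (K + 1)) (κ r).succ)).erase 0).card : ℝ) + t * (if (0 : Fin (K + 1)) ∈ D.image (Equiv.swap (0 : Fin (K + 1)) (κ r).succ) then (1 : ℝ) else 0)
      = ((D.erase 0).card : ℝ) + (if (0 : Fin (K + 1)) ∈ D then (1 : ℝ) else 0) - (1 - t) * (if (κ r).succ ∈ D then (1 : ℝ) else 0) := by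
    intro r
    have h := stale_coldCount_swap D (κ r).succ
    simp only [zero_mem_image_swap_iff]
    have h' : ((((D.image (Equiv.swap (0 : Fin (K + 1)) (κ r).succ)).erase 0).card : ℕ) : ℝ) + (if (κ r).succ ∈ D then (1 : ℝ) else 0)
        = ((D.erase 0).card : ℝ) + (if (0 : Fin (K + 1)) ∈ D then (1 : ℝ) else 0) := by
      have := congrArg (fun n : ℕ => (n : ℝ)) h
      simp only [Nat.cast_add, Nat.cast_ite, Nat.cast_one, Nat.cast_zero] at this
      exact this
    linarith
  simp_rw [e1]
  rw [stale_coldCount_erase, if_neg (Finset.notMem_erase 0 D), mul_zero, add_zero]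
  have e2 : ∀ r : Fin m, ((D.erase 0).card : ℝ) + (if (0 : Fin (K + 1)) ∈ D then (1 : ℝ) else 0) - (1 - t) * (if (κ r).succ ∈ D then (1 : ℝ) else 0)
      = (((D.erase 0).card : ℝ) + (if (0 : Fin (K + 1)) ∈ D then (1 : ℝ) else 0)) + (-(1 - t)) * (if (κ r).succ ∈ D then (1 : ℝ) else 0) := fun r => by ring
  simp_rw [e2]
  rw [stale_sum_affine κ hm hunif D]
  ring

/-- **THE SECOND MOMENT:** `Σ_{D'} Q(D,D')·Φ(D')² ≤ (1−2λ)Φ(D)² + λ(1−t)|D∖{0}| + (3t(1−t) + 2λt²)𝟙{0∈D}`, `λ = t(1−t)/K`, at `m = cK` (`0 ≤ t ≤ 1`). [ours] -/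
theorem stale_potential_sq_step (hm : 1 ≤ m) (ht0 : 0 ≤ t) (ht1 : t ≤ 1) (hK : 1 ≤ K)
    (hQ : ∀ D D', Q D D' = ∑ r : Fin m, t / m * (if D' = D.image (Equiv.swap (0 : Fin (K + 1)) (κ r).succ) then (1 : ℝ)
      else 0) + (1 - t) * (if D' = D.erase 0 then (1 : ℝ) else 0))
    {c : ℕ} (hunif : ∀ i : Fin K, (univ.filter fun r : Fin m => κ r = i).card = c) (hmc : m = c * K) (D : Finset (Fin (K + 1))) :
    ∑ D', Q D D' * (((D'.erase 0).card : ℝ) + t * (if (0 : Fin (K + 1)) ∈ D' then (1 : ℝ) else 0)) ^ 2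
      ≤ (1 - 2 * (t * (1 - t) / K)) * (((D.erase 0).card : ℝ) + t * (if (0 : Fin (K + 1)) ∈ D then (1 : ℝ) else 0)) ^ 2
        + t * (1 - t) / K * (1 - t) * ((D.erase 0).card : ℝ) + (3 * (t * (1 - t)) + 2 * (t * (1 - t) / K) * t ^ 2) * (if (0 : Fin (K + 1)) ∈ D then (1 : ℝ) else 0) := by
  classical
  have hmpos : (0 : ℝ) < m := Nat.cast_pos.mpr (by omega)
  have hKpos : (0 : ℝ) < K := by exact_mod_cast (by omega : 0 < K)
  have hcm : (c : ℝ) / m = 1 / K := by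
    rw [hmc]; push_cast
    have hc0 : (c : ℝ) ≠ 0 := by
      intro hc; rw [hmc] at hmpos; push_cast at hmpos; rw [hc, zero_mul] at hmpos; exact lt_irrefl _ hmpos
    field_simp
  set G : ℝ := ((D.erase 0).card : ℝ) with hGdef
  set h : ℝ := (if (0 : Fin (K + 1)) ∈ D then (1 : ℝ) else 0) with hhdef
  have hG0 : 0 ≤ G := Nat.cast_nonneg _
  have hGK : G ≤ K := by
    have h1 : (D.erase 0).card ≤ ((univ : Finset (Fin (K + 1))).erase 0).card := Finset.card_le_card (Finset.erase_subset_erase 0 (subset_univ D))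
    rw [Finset.card_erase_of_mem (mem_univ _), card_univ, Fintype.card_fin] at h1
    have : (D.erase 0).card ≤ K := by omega
    rw [hGdef]; exact_mod_cast this
  rw [stale_sum_fun κ hQ D]
  have e1 : ∀ r : Fin m, (((D.image (Equiv.swap (0 : Fin (K + 1)) (κ r).succ)).erase 0).card : ℝ) + t * (if (0 : Fin (K + 1)) ∈ D.image (Equiv.swap (0 : Fin (K + 1)) (κ r).succ) then (1 : ℝ) else 0)
      = G + h - (1 - t) * (if (κ r).succ ∈ D then (1 : ℝ) else 0) := by
    intro r
    have hsw := stale_coldCount_swap D (κ r).succ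
    simp only [zero_mem_image_swap_iff]
    have h' : ((((D.image (Equiv.swap (0 : Fin (K + 1)) (κ r).succ)).erase 0).card : ℕ) : ℝ) + (if (κ r).succ ∈ D then (1 : ℝ) else 0) = G + h := by
      have := congrArg (fun n : ℕ => (n : ℝ)) hsw
      simp only [Nat.cast_add, Nat.cast_ite, Nat.cast_one, Nat.cast_zero] at this
      rw [hGdef, hhdef]; exact this
    linarith
  simp_rw [e1]
  rw [stale_coldCount_erase, if_neg (Finset.notMem_erase 0 D), mul_zero, add_zero, ← hGdef]
  -- `(G + h − (1−t)𝟙)² = (G+h)² − 𝟙·(1−t)(2(G+h) − (1−t))` since `𝟙² = 𝟙`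
  have e2 : ∀ r : Fin m, (G + h - (1 - t) * (if (κ r).succ ∈ D then (1 : ℝ) else 0)) ^ 2
      = (G + h) ^ 2 - (if (κ r).succ ∈ D then (1 : ℝ) else 0) * ((1 - t) * (2 * (G + h) - (1 - t))) := by
    intro r; split_ifs <;> ring
  simp_rw [e2]
  have e2' : ∀ r : Fin m, (G + h) ^ 2 - (if (κ r).succ ∈ D then (1 : ℝ) else 0) * ((1 - t) * (2 * (G + h) - (1 - t)))
      = (G + h) ^ 2 + (-((1 - t) * (2 * (G + h) - (1 - t)))) * (if (κ r).succ ∈ D then (1 : ℝ) else 0) := fun r => by ring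
  simp_rw [e2']
  rw [stale_sum_affine κ hm hunif D, ← hGdef]
  have e3 : t * (G + h) ^ 2 + t * c / m * (-((1 - t) * (2 * (G + h) - (1 - t)))) * G + (1 - t) * G ^ 2
      = t * (G + h) ^ 2 - t * (1 - t) / K * G * (2 * (G + h) - (1 - t)) + (1 - t) * G ^ 2 := by
    rw [show t * (c : ℝ) / m = t * (c / m) by ring, hcm]
    field_simp
    ring
  rw [e3]
  -- the two cases of the hub indicator
  have hh : h = 0 ∨ h = 1 := by rw [hhdef]; split_ifs <;> simp
  set lam : ℝ := t * (1 - t) / K with hlam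
  have hlam0 : 0 ≤ lam := div_nonneg (mul_nonneg ht0 (by linarith)) hKpos.le
  rcases hh with h0 | h1
  · rw [h0]; ring_nf; nlinarith
  · rw [h1]
    have key : (1 - 2 * lam) * (G + t * 1) ^ 2 + lam * (1 - t) * G + (3 * (t * (1 - t)) + 2 * lam * t ^ 2) * 1
        - (t * (G + 1) ^ 2 - lam * G * (2 * (G + 1) - (1 - t)) + (1 - t) * G ^ 2) = 2 * lam * ((K : ℝ) - G) + 4 * lam * G * (1 - t) + (3 * (t * (1 - t)) - t * (1 - t) - 2 * lam * K) := by
      ring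
    have hz : 3 * (t * (1 - t)) - t * (1 - t) - 2 * lam * K = 0 := by rw [hlam]; field_simp; ring
    nlinarith [mul_nonneg hlam0 (sub_nonneg.mpr hGK), mul_nonneg (mul_nonneg hlam0 hG0) (sub_nonneg.mpr ht1)]

end StaleSteps

end Summit.Ventures.LatticeQCDFlow.Scaling

end
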